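import Mathlib.Analysis.SpecialFunctions.Pow.Real
import Mathlib.Analysis.SpecialFunctions.Pow.Asymptotics
import HarnessLib

/-!
# Crux `MobiusLadder.LiouvilleOrthogonalTC0` (stmt-QuantumAdvantage-1393), line `Sketch`,
# skeleton v11: stub `stub_thrParams` — restriction-parameter asymptotics for the THR ∘ AC⁰ rung

The v11 threshold-of-`AC⁰` rung runs `H` rounds of random restriction with parameter `p = n^{−δ}`;
the lead's glue consumes exactly three eventual (in `n`) numerical facts, packaged here:

1. `p = n^{−δ} ≤ 1/2`;
2. the multi-switching failure bound at threshold `D + 1`, for families of `≤ n^A` DNFs of width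
   `≤ ℓ` and partial depth `ℓ`,
   `(n^A + 1)^{⌊D/(ℓ+1)⌋ + 1} · (32(ℓ+1) + 1)^{D+1} · (p/(1−p))^{D+1}`, is `≤ η` for every `D` with
   `δ D ≥ 4(A+2)` (uniformly in `D`): for `n ≥ 2`, `p ≤ 1/2` and `66(ℓ+1) ≤ n^{δ/4}` it is at most
   `n^{A + 1 − 3δ/4 − δD/4} ≤ n^{−1}` (`StubThrParams.prod_le`), using `(A+1)/(ℓ+1) ≤ δ/2`;
3. the level chain `D₀ = ⌊n^{1/R}⌋ + 1`, `D_{i+1} = ⌊p D_i / 4⌋` stays `≥ Dmin` up to index `H`: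
   `D_i + 2 ≥ (n^{1/R} + 2)(p/4)^i` (`StubThrParams.chain_lower`) and
   `n^{1/R} (p/4)^i ≥ n^{1/(2R)}/4^H` for `i ≤ H` since `δ H R ≤ 1/2`.

Pure real analysis (Mathlib only).

* `StubThrParams.part_i`, `StubThrParams.part_ii`, `StubThrParams.part_iii` — the three facts;
* `stub_thrParams` — the registered stub, verbatim.
-/

set_option linter.dupNamespace false -- D-0017: single-problem summit ⇒ `QuantumAdvantage.QuantumAdvantage` by design

noncomputable section

namespace Summit.QuantumAdvantage.QuantumAdvantage.Theorems.LiouvilleOrthogonalTC0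

open Filter Finset Real

namespace StubThrParams

/-- (i) `n^{−δ} ≤ 1/2` eventually. -/
theorem part_i {δ : ℝ} (hδ : 0 < δ) : ∀ᶠ n : ℕ in atTop, (n : ℝ) ^ (-δ) ≤ 1 / 2 := by
  have h : Tendsto (fun n : ℕ => (n : ℝ) ^ (-δ)) atTop (nhds 0) :=
    (tendsto_rpow_neg_atTop hδ).comp tendsto_natCast_atTop_atTop
  exact h.eventually (eventually_le_nhds (by norm_num))

/-- The key estimate behind (ii): for `x ≥ 2` with `x^{−δ} ≤ 1/2` and `66(ℓ+1) ≤ x^{δ/4}`, and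
`(A+1)/(ℓ+1) ≤ δ/2`, the multi-switching failure bound at threshold `D + 1` is at most
`x ^ (A + 1 − 3δ/4 − δD/4)`. -/
theorem prod_le (A ℓ D : ℕ) {δ x : ℝ} (hx : 2 ≤ x)
    (hp : x ^ (-δ) ≤ 1 / 2) (h66 : 66 * ((ℓ : ℝ) + 1) ≤ x ^ (δ / 4))
    (hℓ : ((A : ℝ) + 1) / (ℓ + 1) ≤ δ / 2) :
    (x ^ A + 1) ^ (D / (ℓ + 1) + 1) * (32 * ((ℓ : ℝ) + 1) + 1) ^ (D + 1) *
        (x ^ (-δ) / (1 - x ^ (-δ))) ^ (D + 1)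
      ≤ x ^ ((A : ℝ) + 1 - 3 * δ / 4 - δ * D / 4) := by
  have hx0 : 0 < x := by linarith
  have hx1 : 1 ≤ x := by linarith
  have hp0 : 0 < x ^ (-δ) := Real.rpow_pos_of_pos hx0 _
  -- factor 1: `(x^A + 1)^(q+1) ≤ x^(δ D / 2 + A + 1)` with `q = ⌊D/(ℓ+1)⌋`
  have hA1 : x ^ A + 1 ≤ x ^ ((A : ℝ) + 1) := by
    rw [← Nat.cast_succ, Real.rpow_natCast, pow_succ]
    have hxA : 1 ≤ x ^ A := one_le_pow₀ hx1
    have : x ^ A * 2 ≤ x ^ A * x := mul_le_mul_of_nonneg_left hx (by positivity)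
    linarith
  have hf1 : (x ^ A + 1) ^ (D / (ℓ + 1) + 1) ≤ x ^ (δ * D / 2 + A + 1) := by
    calc (x ^ A + 1) ^ (D / (ℓ + 1) + 1) ≤ (x ^ ((A : ℝ) + 1)) ^ (D / (ℓ + 1) + 1) :=
          pow_le_pow_left₀ (by positivity) hA1 _
      _ = x ^ (((A : ℝ) + 1) * ((D / (ℓ + 1) + 1 : ℕ) : ℝ)) :=
          (Real.rpow_mul_natCast hx0.le _ _).symm
      _ ≤ x ^ (δ * D / 2 + A + 1) := by
          apply Real.rpow_le_rpow_of_exponent_le hx1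
          have hq : ((D / (ℓ + 1) : ℕ) : ℝ) ≤ (D : ℝ) / (ℓ + 1) := by
            have h : ((D / (ℓ + 1) : ℕ) : ℝ) ≤ (D : ℝ) / ((ℓ + 1 : ℕ) : ℝ) := Nat.cast_div_le
            push_cast at h
            exact h
          have h1 : ((A : ℝ) + 1) * ((D / (ℓ + 1) : ℕ) : ℝ) ≤ ((A : ℝ) + 1) * ((D : ℝ) / (ℓ + 1)) :=
            mul_le_mul_of_nonneg_left hq (by positivity)
          have h2 : ((A : ℝ) + 1) / (ℓ + 1) * D ≤ δ / 2 * D :=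
            mul_le_mul_of_nonneg_right hℓ (Nat.cast_nonneg D)
          have h3 : ((A : ℝ) + 1) * ((D : ℝ) / (ℓ + 1)) = ((A : ℝ) + 1) / (ℓ + 1) * D := by ring
          push_cast
          linarith [h1, h2, h3]
  -- factor 2: `32(ℓ+1) + 1 ≤ 33(ℓ+1)`
  have hf2 : (32 * ((ℓ : ℝ) + 1) + 1) ^ (D + 1) ≤ (33 * ((ℓ : ℝ) + 1)) ^ (D + 1) := by
    apply pow_le_pow_left₀ (by positivity)
    have : (0 : ℝ) ≤ ℓ := Nat.cast_nonneg ℓ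
    linarith
  -- factor 3: `p/(1-p) ≤ 2p`
  have hC0 : 0 ≤ x ^ (-δ) / (1 - x ^ (-δ)) := div_nonneg hp0.le (by linarith)
  have hf3' : x ^ (-δ) / (1 - x ^ (-δ)) ≤ 2 * x ^ (-δ) := by
    rw [div_le_iff₀ (by linarith)]
    nlinarith
  have hf3 : (x ^ (-δ) / (1 - x ^ (-δ))) ^ (D + 1) ≤ (2 : ℝ) ^ (D + 1) * (x ^ (-δ)) ^ (D + 1) := by
    rw [← mul_pow]
    exact pow_le_pow_left₀ hC0 hf3' _
  -- the constant: `(66(ℓ+1))^(D+1) ≤ (x^(δ/4))^(D+1)`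
  have hf4 : (66 * ((ℓ : ℝ) + 1)) ^ (D + 1) ≤ (x ^ (δ / 4)) ^ (D + 1) :=
    pow_le_pow_left₀ (by positivity) h66 _
  have h66 : (33 * ((ℓ : ℝ) + 1)) ^ (D + 1) * (2 : ℝ) ^ (D + 1) = (66 * ((ℓ : ℝ) + 1)) ^ (D + 1) := by
    rw [← mul_pow]
    congr 1
    ring
  -- combine
  calc (x ^ A + 1) ^ (D / (ℓ + 1) + 1) * (32 * ((ℓ : ℝ) + 1) + 1) ^ (D + 1)
        * (x ^ (-δ) / (1 - x ^ (-δ))) ^ (D + 1)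
      ≤ x ^ (δ * D / 2 + A + 1) * (33 * ((ℓ : ℝ) + 1)) ^ (D + 1)
          * ((2 : ℝ) ^ (D + 1) * (x ^ (-δ)) ^ (D + 1)) :=
        mul_le_mul (mul_le_mul hf1 hf2 (by positivity) (by positivity)) hf3
          (pow_nonneg hC0 _) (by positivity)
    _ = x ^ (δ * D / 2 + A + 1) *
          (((33 * ((ℓ : ℝ) + 1)) ^ (D + 1) * (2 : ℝ) ^ (D + 1)) * (x ^ (-δ)) ^ (D + 1)) := by
        ring
    _ ≤ x ^ (δ * D / 2 + A + 1) * ((x ^ (δ / 4)) ^ (D + 1) * (x ^ (-δ)) ^ (D + 1)) := by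
        rw [h66]
        apply mul_le_mul_of_nonneg_left _ (by positivity)
        exact mul_le_mul_of_nonneg_right hf4 (by positivity)
    _ = x ^ (δ * D / 2 + A + 1 + (δ / 4 + -δ) * ((D + 1 : ℕ) : ℝ)) := by
        rw [← mul_pow, ← Real.rpow_add hx0, ← Real.rpow_mul_natCast hx0.le,
          ← Real.rpow_add hx0]
    _ = x ^ ((A : ℝ) + 1 - 3 * δ / 4 - δ * D / 4) := by
        congr 1
        push_cast
        ring

/-- (ii) The multi-switching failure bound is eventually `≤ η`, uniformly in the threshold `D` with
`δ D ≥ 4(A+2)`. -/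
theorem part_ii (A ℓ : ℕ) {δ : ℝ} (hδ : 0 < δ) (hℓ : ((A : ℝ) + 1) / (ℓ + 1) ≤ δ / 2)
    {η : ℝ} (hη : 0 < η) :
    ∀ᶠ n : ℕ in atTop, ∀ D : ℕ, 4 * ((A : ℝ) + 2) ≤ δ * D →
        ((n : ℝ) ^ A + 1) ^ (D / (ℓ + 1) + 1) * (32 * ((ℓ : ℝ) + 1) + 1) ^ (D + 1) *
            ((n : ℝ) ^ (-δ) / (1 - (n : ℝ) ^ (-δ))) ^ (D + 1) ≤ η := by
  have e2 : ∀ᶠ n : ℕ in atTop, 66 * ((ℓ : ℝ) + 1) ≤ (n : ℝ) ^ (δ / 4) :=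
    ((tendsto_rpow_atTop (by positivity)).comp tendsto_natCast_atTop_atTop).eventually_ge_atTop _
  have e4 : ∀ᶠ n : ℕ in atTop, η⁻¹ ≤ (n : ℝ) := tendsto_natCast_atTop_atTop.eventually_ge_atTop _
  filter_upwards [part_i hδ, e2, eventually_ge_atTop 2, e4] with n hn1 hn2 hn3 hn4 D hD
  have hx : (2 : ℝ) ≤ n := by exact_mod_cast hn3
  have hx0 : (0 : ℝ) < n := by linarith
  refine (prod_le A ℓ D hx hn1 hn2 hℓ).trans ?_
  calc (n : ℝ) ^ ((A : ℝ) + 1 - 3 * δ / 4 - δ * D / 4) ≤ (n : ℝ) ^ (-1 : ℝ) := by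
        apply Real.rpow_le_rpow_of_exponent_le (by linarith)
        linarith [hδ.le]
    _ = (n : ℝ)⁻¹ := Real.rpow_neg_one _
    _ ≤ η := inv_le_of_inv_le₀ hη hn4

/-- The level-chain invariant: with `0 ≤ p ≤ 1`, `x ≤ k₀` and `D_{i+1} = ⌊p D_i / 4⌋`, `D₀ = k₀`,
one has `(x + 2)(p/4)^i ≤ D_i + 2`. -/
theorem chain_lower {x p : ℝ} (hp0 : 0 ≤ p) (hp1 : p ≤ 1) (k₀ : ℕ) (hk : x ≤ k₀) (i : ℕ) :
    (x + 2) * (p / 4) ^ i ≤ ((fun D : ℕ => ⌊p * D / 4⌋₊)^[i] k₀ : ℝ) + 2 := by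
  induction i with
  | zero => simpa using hk
  | succ i ih =>
    rw [Function.iterate_succ_apply', pow_succ, ← mul_assoc]
    have h1 := Nat.lt_floor_add_one (p * ((fun D : ℕ => ⌊p * D / 4⌋₊)^[i] k₀ : ℝ) / 4)
    have h2 : (x + 2) * (p / 4) ^ i * (p / 4) ≤
        (((fun D : ℕ => ⌊p * D / 4⌋₊)^[i] k₀ : ℝ) + 2) * (p / 4) :=
      mul_le_mul_of_nonneg_right ih (by positivity)
    nlinarith [h1, h2]

/-- (iii) The level chain `D₀ = ⌊n^{1/R}⌋ + 1`, `D_{i+1} = ⌊n^{−δ} D_i / 4⌋` stays `≥ Dmin` up to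
index `H`, eventually in `n`, as soon as `δ H R ≤ 1/2`. -/
theorem part_iii (R H Dmin : ℕ) (hR : 1 ≤ R) {δ : ℝ} (hδ : 0 < δ) (hδR : δ * H * R ≤ 1 / 2) :
    ∀ᶠ n : ℕ in atTop, ∀ i, i ≤ H →
      Dmin ≤ (fun D : ℕ => ⌊(n : ℝ) ^ (-δ) * D / 4⌋₊)^[i] (⌊(n : ℝ) ^ ((1 : ℝ) / R)⌋₊ + 1) := by
  have hR0 : (0 : ℝ) < R := by exact_mod_cast hR
  have e1 : ∀ᶠ n : ℕ in atTop, ((Dmin : ℝ) + 2) * 4 ^ H ≤ (n : ℝ) ^ (1 / (2 * (R : ℝ))) :=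
    ((tendsto_rpow_atTop (by positivity)).comp tendsto_natCast_atTop_atTop).eventually_ge_atTop _
  filter_upwards [e1, eventually_ge_atTop 1] with n hn1 hn2 i hi
  have hx1 : (1 : ℝ) ≤ n := by exact_mod_cast hn2
  have hx0 : (0 : ℝ) < n := by linarith
  have hp0 : 0 ≤ (n : ℝ) ^ (-δ) := (Real.rpow_pos_of_pos hx0 _).le
  have hp1 : (n : ℝ) ^ (-δ) ≤ 1 := Real.rpow_le_one_of_one_le_of_nonpos hx1 (by linarith)
  have hk : (n : ℝ) ^ ((1 : ℝ) / R) ≤ ((⌊(n : ℝ) ^ ((1 : ℝ) / R)⌋₊ + 1 : ℕ) : ℝ) := by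
    push_cast
    exact (Nat.lt_floor_add_one _).le
  have hchain := chain_lower hp0 hp1 _ hk i
  have hpi : ((n : ℝ) ^ (-δ) / 4) ^ H ≤ ((n : ℝ) ^ (-δ) / 4) ^ i :=
    pow_le_pow_of_le_one (by positivity) (by linarith) hi
  have hxpos : 0 ≤ (n : ℝ) ^ ((1 : ℝ) / R) := by positivity
  have key : (Dmin : ℝ) + 2 ≤ ((n : ℝ) ^ ((1 : ℝ) / R) + 2) * ((n : ℝ) ^ (-δ) / 4) ^ i := by
    calc (Dmin : ℝ) + 2 ≤ (n : ℝ) ^ (1 / (2 * (R : ℝ))) / 4 ^ H := by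
          rw [le_div_iff₀ (by positivity)]
          exact hn1
      _ ≤ (n : ℝ) ^ ((1 : ℝ) / R) * ((n : ℝ) ^ (-δ)) ^ H / 4 ^ H := by
          apply div_le_div_of_nonneg_right _ (by positivity)
          rw [← Real.rpow_mul_natCast hx0.le, ← Real.rpow_add hx0]
          apply Real.rpow_le_rpow_of_exponent_le hx1
          have h1 : δ * H ≤ 1 / (2 * R) := by
            rw [le_div_iff₀ (by positivity)]
            nlinarith
          have h2 : (1 : ℝ) / (2 * R) = 1 / R - 1 / (2 * R) := by
            field_simp
            ring
          linarith
      _ = (n : ℝ) ^ ((1 : ℝ) / R) * ((n : ℝ) ^ (-δ) / 4) ^ H := by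
          rw [div_pow]
          ring
      _ ≤ (n : ℝ) ^ ((1 : ℝ) / R) * ((n : ℝ) ^ (-δ) / 4) ^ i :=
          mul_le_mul_of_nonneg_left hpi hxpos
      _ ≤ ((n : ℝ) ^ ((1 : ℝ) / R) + 2) * ((n : ℝ) ^ (-δ) / 4) ^ i := by
          have : 0 ≤ ((n : ℝ) ^ (-δ) / 4) ^ i := by positivity
          nlinarith
  have : (Dmin : ℝ) ≤ ((fun D : ℕ => ⌊(n : ℝ) ^ (-δ) * D / 4⌋₊)^[i]
      (⌊(n : ℝ) ^ ((1 : ℝ) / R)⌋₊ + 1) : ℝ) := by linarith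
  exact_mod_cast this

end StubThrParams

/-- **Stub `stub_thrParams` (v11, THR ∘ AC⁰ rung) — restriction-parameter asymptotics.** With
`p = n^{−δ}`, `δ > 0`, `δ H R ≤ 1/2`, `R ≥ 1` and `(A+1)/(ℓ+1) ≤ δ/2`: for every `η > 0`,
eventually in `n`, (i) `p ≤ 1/2`; (ii) for every threshold `D` with `δ D ≥ 4(A+2)` the
multi-switching failure bound `(n^A+1)^{⌊D/(ℓ+1)⌋+1} (32(ℓ+1)+1)^{D+1} (p/(1−p))^{D+1}` is `≤ η`;
(iii) the level chain `D₀ = ⌊n^{1/R}⌋ + 1`, `D_{i+1} = ⌊p D_i/4⌋` is `≥ Dmin` for all `i ≤ H`. -/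
theorem stub_thrParams (R H A ℓ Dmin : ℕ) (hR : 1 ≤ R) {δ : ℝ} (hδ : 0 < δ)
    (hδR : δ * H * R ≤ 1 / 2) (hℓ : ((A : ℝ) + 1) / (ℓ + 1) ≤ δ / 2) :
    ∀ η : ℝ, 0 < η → ∀ᶠ n : ℕ in atTop, (n : ℝ) ^ (-δ) ≤ 1 / 2 ∧
      (∀ D : ℕ, 4 * ((A : ℝ) + 2) ≤ δ * D →
        ((n : ℝ) ^ A + 1) ^ (D / (ℓ + 1) + 1) * (32 * ((ℓ : ℝ) + 1) + 1) ^ (D + 1) *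
            ((n : ℝ) ^ (-δ) / (1 - (n : ℝ) ^ (-δ))) ^ (D + 1) ≤ η) ∧
      ∀ i, i ≤ H → Dmin ≤ (fun D : ℕ => ⌊(n : ℝ) ^ (-δ) * D / 4⌋₊)^[i] (⌊(n : ℝ) ^ ((1 : ℝ) / R)⌋₊ + 1) := by
  intro η hη
  filter_upwards [StubThrParams.part_i hδ, StubThrParams.part_ii A ℓ hδ hℓ hη,
    StubThrParams.part_iii R H Dmin hR hδ hδR] with n h1 h2 h3
  exact ⟨h1, h2, h3⟩

end Summit.QuantumAdvantage.QuantumAdvantage.Theorems.LiouvilleOrthogonalTC0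

end
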